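import Mathlib
import Summits.Ventures.HodgeRepro.Tier4.Common.AdelicDefs
import Summits.Ventures.HodgeRepro.Tier4.Line1.PlaneDefs
import Summits.Ventures.HodgeRepro.Tier4.Line1.ThreeLines
import Summits.Ventures.HodgeRepro.Tier4.Line1.RationalConjScalar

/-!
# Tier4/Line4/LineScalars — the `E′_𝔸`-scalars of a torus element on its two lines, and their NORM ONE

Blind re-derivation cell `pub-hodge-repro`, Tier 4 «PROVE THE STEP» (README §9–§10), LINE L4, cut C-L4-PROPER
(t4-plan-4 g3 S14566, statement S14602), seat t4-L2-p3 (gen 4); module 1 of the cut (the scalar algebra).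

* `esc x y = x·1 + y·Ω` (adelic `E′`-scalars): products (`esc_mul_esc`), commutation with every `Ω`-commuting
  rational matrix, action on rational vectors (`esc_mulVec`);
* `exists_coordMatrix`: for a rational `v ≠ 0` a rational `2 × 4` matrix `R` with `R v = e₀`, `R (Ωv) = e₁` (a left
  inverse of `(x, y) ↦ x v + y Ωv`, from `linearIndependent_pair_mulVec`), `coord_esc_mulVec`: its base change reads the
  coordinates off `esc x y *ᵥ v`; hence `E′_𝔸` acts FAITHFULLY on a rational line (`eq_zero_of_esc_mulVec_eq_zero`);
* `exists_esc_mul_eq`: an adelic matrix commuting with `Ω` and with an `E′`-line projector is an `E′_𝔸`-scalar on that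
  line (`Y A = esc x y A`; the per-line half of L1-p3's `mat_eq_scalar_of_three_lines'`); `exists_esc_decomp`: a matrix
  commuting with `Ω` and a complementary pair of line projectors is `esc x₀ y₀ P₀ + esc x₁ y₁ P₁`;
* **`nrm_eq_one_of_unitary`**: for `B` invertible, `M B Mᵀ = B` forces `x_i² + d y_i² = 1` on each line (the unitarity of
  a torus element is the norm-one condition of its line scalars).  WHY `B` INVERTIBLE IS NEEDED (junk test, S14602): for
  `B = 0` every field of `IsGenuineRow` and `IsLinRegular` can hold while `T = (E′^×)²` carries no norm condition and
  C-L4-PROPER is FALSE.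

Mathlib + the line's landed modules only; no printed input; nothing here asserts anything about the truth of (P);
HC_CM is NOT proved by anyone in this repository.
-/

set_option autoImplicit false

noncomputable section

namespace Summit.Ventures.HodgeRepro.Tier4.Line4

open Summit.Ventures.HodgeRepro.Tier4 Summit.Ventures.HodgeRepro.Tier4.Common
  Summit.Ventures.HodgeRepro.Tier4.Line1 Matrix NumberField IsDedekindDomain
open scoped Pointwise NumberField

variable {k : Type} [Field k] [NumberField k] (W : PlaneData k)

/-! ## 1. `E′_𝔸`-scalars -/

section Scalars

/-- The adelic `E′`-scalar `x · 1 + y · Ω`. -/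
def esc (x y : Ad k) : M4 k := x • (1 : M4 k) + y • adMat k W.Ω

/-- an `E′`-scalar commutes with every rational matrix commuting with `Ω` -/
theorem esc_mul_adMat_comm (x y : Ad k) {A : Matrix (Fin 4) (Fin 4) k} (hA : A * W.Ω = W.Ω * A) :
    esc W x y * adMat k A = adMat k A * esc W x y := by
  have h : adMat k W.Ω * adMat k A = adMat k A * adMat k W.Ω := by rw [← adMat_mul, ← hA, adMat_mul]
  simp only [esc, add_mul, mul_add, smul_mul_assoc, mul_smul_comm, one_mul, mul_one, h]

/-- an `E′`-scalar commutes with every adelic matrix commuting with `Ω` -/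
theorem esc_mul_comm (x y : Ad k) (N : M4 k) (hN : N * adMat k W.Ω = adMat k W.Ω * N) :
    esc W x y * N = N * esc W x y := by
  simp only [esc, add_mul, mul_add, smul_mul_assoc, mul_smul_comm, one_mul, mul_one, hN]

/-- the product of two `E′`-scalars, coordinatewise (`Ω² = −d`) -/
theorem esc_mul_esc {d : k} (hΩ : W.Ω * W.Ω = -(d • (1 : Matrix (Fin 4) (Fin 4) k))) (x y x' y' : Ad k) :
    esc W x y * esc W x' y' =
      esc W (x * x' - algebraMap k (Ad k) d * (y * y')) (x * y' + y * x') := by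
  have hΩ2 : adMat k W.Ω * adMat k W.Ω = -(algebraMap k (Ad k) d • (1 : M4 k)) := by
    rw [← adMat_mul, hΩ]
    ext i j
    simp only [adMat, Matrix.map_apply, Matrix.neg_apply, Matrix.smul_apply, Matrix.one_apply, smul_eq_mul,
      map_neg, map_mul]
    split_ifs <;> simp
  simp only [esc, add_mul, mul_add, smul_mul_assoc, mul_smul_comm, one_mul, mul_one, hΩ2]
  module

/-- `esc x y` acting on a rational vector: `x • v + y • Ωv`. -/
theorem esc_mulVec (x y : Ad k) (v : Fin 4 → k) :
    esc W x y *ᵥ (algebraMap k (Ad k) ∘ v) =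
      x • (algebraMap k (Ad k) ∘ v) + y • (algebraMap k (Ad k) ∘ (W.Ω *ᵥ v)) := by
  simp only [esc, add_mulVec, smul_mulVec, one_mulVec, adMat_mulVec_comp]

/-- **The rational coordinate matrix of an `E′`-line**: for `v ≠ 0` there is a rational `2 × 4` matrix `R` with
`R v = e₀`, `R (Ωv) = e₁` (a left inverse of `(x, y) ↦ x v + y Ωv`; `v, Ωv` are linearly independent by
`linearIndependent_pair_mulVec`). -/
theorem exists_coordMatrix {d : k} (hΩ : W.Ω * W.Ω = -(d • (1 : Matrix (Fin 4) (Fin 4) k)))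
    (hd : ¬ IsSquare (-d)) {v : Fin 4 → k} (hv : v ≠ 0) :
    ∃ R : Matrix (Fin 2) (Fin 4) k, R *ᵥ v = Pi.single 0 1 ∧ R *ᵥ (W.Ω *ᵥ v) = Pi.single 1 1 := by
  have hli := linearIndependent_pair_mulVec W hΩ hd hv
  have hinj := hli.fintypeLinearCombination_injective
  set L := Fintype.linearCombination k ![v, W.Ω *ᵥ v] with hL
  obtain ⟨R, hR⟩ := L.exists_leftInverse_of_injective (LinearMap.ker_eq_bot.2 hinj)
  have h0 : L (Pi.single 0 1) = v := by
    rw [hL, Fintype.linearCombination_apply_single, one_smul]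
    rfl
  have h1 : L (Pi.single 1 1) = W.Ω *ᵥ v := by
    rw [hL, Fintype.linearCombination_apply_single, one_smul]
    rfl
  refine ⟨LinearMap.toMatrix' R, ?_, ?_⟩
  · rw [LinearMap.toMatrix'_mulVec, ← h0, ← LinearMap.comp_apply, hR, LinearMap.id_apply]
  · rw [LinearMap.toMatrix'_mulVec, ← h1, ← LinearMap.comp_apply, hR, LinearMap.id_apply]

/-- the adelic coordinates along `v`: `R_𝔸 (esc x y *ᵥ v) = ![x, y]`. -/
theorem coord_esc_mulVec {R : Matrix (Fin 2) (Fin 4) k} {v : Fin 4 → k}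
    (hR0 : R *ᵥ v = Pi.single 0 1) (hR1 : R *ᵥ (W.Ω *ᵥ v) = Pi.single 1 1) (x y : Ad k) :
    R.map (algebraMap k (Ad k)) *ᵥ (esc W x y *ᵥ (algebraMap k (Ad k) ∘ v)) = ![x, y] := by
  have hmap : ∀ w : Fin 4 → k, R.map (algebraMap k (Ad k)) *ᵥ (algebraMap k (Ad k) ∘ w) =
      algebraMap k (Ad k) ∘ (R *ᵥ w) := by
    intro w
    funext i
    exact (RingHom.map_mulVec (algebraMap k (Ad k)) R w i).symm
  rw [esc_mulVec, mulVec_add, mulVec_smul, mulVec_smul, hmap, hmap, hR0, hR1]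
  funext i
  fin_cases i <;> simp

/-- **`E′_𝔸` acts faithfully on a rational line**: `esc x y *ᵥ v = 0` with `v ≠ 0` rational forces `x = y = 0`. -/
theorem eq_zero_of_esc_mulVec_eq_zero {d : k} (hΩ : W.Ω * W.Ω = -(d • (1 : Matrix (Fin 4) (Fin 4) k)))
    (hd : ¬ IsSquare (-d)) {v : Fin 4 → k} (hv : v ≠ 0) {x y : Ad k}
    (h : esc W x y *ᵥ (algebraMap k (Ad k) ∘ v) = 0) : x = 0 ∧ y = 0 := by
  obtain ⟨R, hR0, hR1⟩ := exists_coordMatrix W hΩ hd hv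
  have hc := coord_esc_mulVec W hR0 hR1 x y
  rw [h, mulVec_zero] at hc
  have h0 := congrFun hc 0
  have h1 := congrFun hc 1
  simp only [Pi.zero_apply, Matrix.cons_val_zero, Matrix.cons_val_one] at h0 h1
  exact ⟨h0.symm, h1.symm⟩

end Scalars

/-! ## 2. A matrix commuting with `Ω` and with a line projector is an `E′_𝔸`-scalar on that line -/

section LineScalar

omit [NumberField k] in
/-- a rank-`2` matrix has a non-zero vector in its range -/
theorem exists_ne_zero_mem_range {A : Matrix (Fin 4) (Fin 4) k} (hr : A.rank = 2) :
    ∃ z : Fin 4 → k, z ≠ 0 ∧ z ∈ LinearMap.range A.mulVecLin := by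
  have hne : LinearMap.range A.mulVecLin ≠ ⊥ := by
    intro h
    have h2 : Module.finrank k (LinearMap.range A.mulVecLin) = 2 := hr
    rw [h, finrank_bot] at h2
    exact absurd h2 (by norm_num)
  obtain ⟨z, hzA, hz⟩ := Submodule.exists_mem_ne_zero_of_ne_bot hne
  exact ⟨z, hz, hzA⟩

/-- **an adelic matrix commuting with `Ω` and with an `E′`-line projector `A` acts on the line as an `E′_𝔸`-scalar**:
`Y * A = esc x y * A` (the second half of `mat_eq_scalar_of_three_lines'`, one line at a time). -/
theorem exists_esc_mul_eq {d : k} (hΩ : W.Ω * W.Ω = -(d • (1 : Matrix (Fin 4) (Fin 4) k)))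
    (hd : ¬ IsSquare (-d)) {A : Matrix (Fin 4) (Fin 4) k} (hAΩ : A * W.Ω = W.Ω * A) (hAr : A.rank = 2)
    {Y : M4 k} (hYΩ : Y * adMat k W.Ω = adMat k W.Ω * Y) (hYA : Y * adMat k A = adMat k A * Y) :
    ∃ x y : Ad k, Y * adMat k A = esc W x y * adMat k A := by
  set ι := algebraMap k (Ad k) with hι
  obtain ⟨z, hz, hzA⟩ := exists_ne_zero_mem_range hAr
  have hspan := range_le_span_pair W hΩ hd hAΩ hAr hz hzA
  obtain ⟨z', hz'⟩ := hzA
  have hz'' : adMat k A *ᵥ (ι ∘ z') = ι ∘ z := by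
    rw [adMat_mulVec_comp, ← hz']
    rfl
  have h2 : Y *ᵥ (ι ∘ z) = adMat k A *ᵥ (Y *ᵥ (ι ∘ z')) := by
    rw [← hz'', mulVec_mulVec, hYA, ← mulVec_mulVec]
  have h1 : Y *ᵥ (ι ∘ z) ∈ Submodule.span (Ad k) {ι ∘ z, ι ∘ (W.Ω *ᵥ z)} := by
    rw [h2]
    exact mulVec_adMat_mem_span W hspan _
  obtain ⟨x, y, hxy⟩ := Submodule.mem_span_pair.mp h1
  refine ⟨x, y, ?_⟩
  set N : M4 k := Y - esc W x y with hN
  have hNΩ : N * adMat k W.Ω = adMat k W.Ω * N := by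
    rw [hN, sub_mul, mul_sub, hYΩ, esc_mul_adMat_comm W x y rfl]
  have hNz : N *ᵥ (ι ∘ z) = 0 := by
    rw [hN, sub_mulVec, esc_mulVec, hxy, sub_self]
  have hNΩz : N *ᵥ (ι ∘ (W.Ω *ᵥ z)) = 0 := by
    rw [← adMat_mulVec_comp, mulVec_mulVec, hNΩ, ← mulVec_mulVec, hNz, mulVec_zero]
  have key : ∀ w : Fin 4 → Ad k, (N * adMat k A) *ᵥ w = 0 := by
    intro w
    rw [← mulVec_mulVec]
    obtain ⟨a, b, hab⟩ := Submodule.mem_span_pair.mp (mulVec_adMat_mem_span W hspan w)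
    rw [← hab, mulVec_add, mulVec_smul, mulVec_smul, hNz, hNΩz, smul_zero, smul_zero, add_zero]
  have hNA : N * adMat k A = 0 := by
    ext i j
    have h := congrFun (key (Pi.single j 1)) i
    rw [mulVec_single_one] at h
    simpa using h
  rw [hN, sub_mul, sub_eq_zero] at hNA
  exact hNA

end LineScalar

/-! ## 3. Torus elements: a pair of line scalars, of NORM ONE -/

section Torus

/-- `adMat 0 = 0` -/
theorem adMat_zero : adMat k (0 : Matrix (Fin 4) (Fin 4) k) = 0 := Matrix.map_zero _ (map_zero _)

/-- the transpose of an `E′`-scalar -/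
theorem esc_transpose (x y : Ad k) : (esc W x y)ᵀ = x • (1 : M4 k) + y • adMat k W.Ωᵀ := by
  simp only [esc, transpose_add, transpose_smul, transpose_one, adMat_transpose]

/-- the norm `x² + d y²` of the scalar `x + yΩ` -/
def nrm (d : k) (x y : Ad k) : Ad k := x * x + algebraMap k (Ad k) d * (y * y)

/-- `(x + yΩ)(x − yΩ) = (x² + d y²) · 1` -/
theorem esc_mul_esc_conj {d : k} (hΩ : W.Ω * W.Ω = -(d • (1 : Matrix (Fin 4) (Fin 4) k))) (x y : Ad k) :
    esc W x y * esc W x (-y) = nrm d x y • (1 : M4 k) := by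
  rw [esc_mul_esc W hΩ]
  have h1 : x * (-y) + y * x = 0 := by ring
  have h2 : x * x - algebraMap k (Ad k) d * (y * (-y)) = nrm d x y := by
    simp only [nrm]
    ring
  rw [h1, h2]
  simp only [esc, zero_smul, add_zero]

omit [NumberField k] in
/-- complementary idempotents are orthogonal -/
theorem mul_eq_zero_of_ne (P : Fin 2 → Matrix (Fin 4) (Fin 4) k) (hPi : ∀ i, P i * P i = P i)
    (hsum : P 0 + P 1 = 1) {i j : Fin 2} (hij : i ≠ j) : P i * P j = 0 := by
  have h01 : P 0 * P 1 = 0 := by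
    have h := congrArg (fun A => P 0 * A) hsum
    simp only [mul_add, hPi 0, mul_one] at h
    exact add_left_cancel (h.trans (add_zero _).symm)
  have h10 : P 1 * P 0 = 0 := by
    have h := congrArg (fun A => P 1 * A) hsum
    simp only [mul_add, hPi 1, mul_one] at h
    exact add_right_cancel (h.trans (zero_add _).symm)
  fin_cases i <;> fin_cases j <;> simp_all

/-- the two-line decomposition of an adelic matrix commuting with `Ω` and with a complementary pair of `E′`-line
projectors: `Y = esc x₀ y₀ P₀ + esc x₁ y₁ P₁`. -/
theorem exists_esc_decomp {d : k} (hΩ : W.Ω * W.Ω = -(d • (1 : Matrix (Fin 4) (Fin 4) k)))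
    (hd : ¬ IsSquare (-d)) (P : Fin 2 → Matrix (Fin 4) (Fin 4) k) (hPΩ : ∀ i, P i * W.Ω = W.Ω * P i)
    (hPr : ∀ i, (P i).rank = 2) (hsum : P 0 + P 1 = 1) {Y : M4 k}
    (hYΩ : Y * adMat k W.Ω = adMat k W.Ω * Y) (hYP : ∀ i, Y * adMat k (P i) = adMat k (P i) * Y) :
    ∃ x y : Fin 2 → Ad k, Y = esc W (x 0) (y 0) * adMat k (P 0) + esc W (x 1) (y 1) * adMat k (P 1) := by
  obtain ⟨x₀, y₀, h0⟩ := exists_esc_mul_eq W hΩ hd (hPΩ 0) (hPr 0) hYΩ (hYP 0)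
  obtain ⟨x₁, y₁, h1⟩ := exists_esc_mul_eq W hΩ hd (hPΩ 1) (hPr 1) hYΩ (hYP 1)
  refine ⟨![x₀, x₁], ![y₀, y₁], ?_⟩
  simp only [Matrix.cons_val_zero, Matrix.cons_val_one]
  calc Y = Y * adMat k (P 0 + P 1) := by rw [hsum, adMat_one, mul_one]
    _ = Y * adMat k (P 0) + Y * adMat k (P 1) := by rw [adMat_add, mul_add]
    _ = _ := by rw [h0, h1]

/-- **unitarity forces norm one on each line** (for `B` invertible): if `M = esc x₀ y₀ P₀ + esc x₁ y₁ P₁` satisfies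
`M B Mᵀ = B`, then `x_i² + d y_i² = 1`. -/
theorem nrm_eq_one_of_unitary {d : k} (hΩ : W.Ω * W.Ω = -(d • (1 : Matrix (Fin 4) (Fin 4) k)))
    (hΩB : W.Ω * W.B = -(W.B * W.Ωᵀ)) (hdet : W.B.det ≠ 0)
    (P : Fin 2 → Matrix (Fin 4) (Fin 4) k) (hPΩ : ∀ i, P i * W.Ω = W.Ω * P i)
    (hPB : ∀ i, P i * W.B = W.B * (P i)ᵀ) (hPi : ∀ i, P i * P i = P i) (hPr : ∀ i, (P i).rank = 2)
    (hsum : P 0 + P 1 = 1) (x y : Fin 2 → Ad k) {M : M4 k}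
    (hM : M = esc W (x 0) (y 0) * adMat k (P 0) + esc W (x 1) (y 1) * adMat k (P 1))
    (hunit : M * adMat k W.B * Mᵀ = adMat k W.B) (i : Fin 2) : nrm d (x i) (y i) = 1 := by
  set ι := algebraMap k (Ad k) with hι
  set B := adMat k W.B with hBdef
  -- (a) `B (esc x y)ᵀ = esc x (−y) B`
  have hBT : ∀ x y : Ad k, B * (esc W x y)ᵀ = esc W x (-y) * B := by
    intro x y
    have h0 : W.B * W.Ωᵀ = -(W.Ω * W.B) := by rw [hΩB, neg_neg]
    have h1 : adMat k W.B * adMat k W.Ωᵀ = -(adMat k W.Ω * adMat k W.B) := by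
      rw [← adMat_mul, ← adMat_mul, h0, adMat_neg]
    rw [esc_transpose, esc, mul_add, add_mul, mul_smul_comm, mul_smul_comm, mul_one, smul_mul_assoc,
      smul_mul_assoc, one_mul, hBdef, h1, smul_neg, neg_smul]
  -- (b) `P_i B P_jᵀ = P_i P_j B`
  have hPBP : ∀ i j : Fin 2, adMat k (P i) * B * (adMat k (P j))ᵀ = adMat k (P i) * adMat k (P j) * B := by
    intro i j
    rw [mul_assoc, mul_assoc, hBdef, ← adMat_transpose, ← adMat_mul, ← hPB j, adMat_mul]
  -- (c) the terms of the expansion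
  have hterm : ∀ i j : Fin 2, (esc W (x i) (y i) * adMat k (P i)) * B * ((adMat k (P j))ᵀ * (esc W (x j) (y j))ᵀ) =
      if i = j then nrm d (x i) (y i) • (adMat k (P i) * B) else 0 := by
    intro i j
    have h := hPBP i j
    calc (esc W (x i) (y i) * adMat k (P i)) * B * ((adMat k (P j))ᵀ * (esc W (x j) (y j))ᵀ)
        = esc W (x i) (y i) * (adMat k (P i) * B * (adMat k (P j))ᵀ) * (esc W (x j) (y j))ᵀ := by
          simp only [mul_assoc]
      _ = esc W (x i) (y i) * (adMat k (P i) * adMat k (P j) * B) * (esc W (x j) (y j))ᵀ := by rw [h]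
      _ = _ := by
        by_cases hij : i = j
        · subst hij
          rw [if_pos rfl, ← adMat_mul, hPi i, mul_assoc, mul_assoc, hBT, ← mul_assoc (adMat k (P i)),
            ← esc_mul_adMat_comm W _ _ (hPΩ i), ← mul_assoc, ← mul_assoc, esc_mul_esc_conj W hΩ,
            smul_mul_assoc, smul_mul_assoc, one_mul]
        · rw [if_neg hij, ← adMat_mul, mul_eq_zero_of_ne P hPi hsum hij, adMat_zero, zero_mul, mul_zero, zero_mul]
  -- (d) the expansion: `Σ nrm_i • (P_i B) = B`
  have hexp : nrm d (x 0) (y 0) • (adMat k (P 0) * B) + nrm d (x 1) (y 1) • (adMat k (P 1) * B) = B := by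
    have h := hunit
    rw [hM, transpose_add, transpose_mul, transpose_mul, add_mul, mul_add, add_mul, add_mul,
      hterm 0 0, hterm 0 1, hterm 1 0, hterm 1 1] at h
    simpa using h
  -- (e) isolate line `i`: `nrm_i • (P_i B) = P_i B`
  have hline0 : nrm d (x 0) (y 0) • (adMat k (P 0) * B) = adMat k (P 0) * B := by
    have h := congrArg (fun A => adMat k (P 0) * A) hexp
    simp only [mul_add, mul_smul_comm, ← mul_assoc, ← adMat_mul, hPi 0,
      mul_eq_zero_of_ne P hPi hsum (show (0 : Fin 2) ≠ 1 by decide), adMat_zero, zero_mul, smul_zero,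
      add_zero] at h
    exact h
  have hline1 : nrm d (x 1) (y 1) • (adMat k (P 1) * B) = adMat k (P 1) * B := by
    have h := congrArg (fun A => adMat k (P 1) * A) hexp
    simp only [mul_add, mul_smul_comm, ← mul_assoc, ← adMat_mul, hPi 1,
      mul_eq_zero_of_ne P hPi hsum (show (1 : Fin 2) ≠ 0 by decide), adMat_zero, zero_mul, smul_zero,
      zero_add] at h
    exact h
  have hline : nrm d (x i) (y i) • (adMat k (P i) * B) = adMat k (P i) * B := by
    fin_cases i
    · exact hline0
    · exact hline1
  -- (f) cancel `B` (invertible) and read off an entry of `P_i ≠ 0`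
  have hBinv : B * adMat k W.B⁻¹ = 1 := by
    rw [hBdef, ← adMat_mul, Matrix.mul_nonsing_inv _ (isUnit_iff_ne_zero.2 hdet), adMat_one]
  have hPeq : nrm d (x i) (y i) • adMat k (P i) = adMat k (P i) := by
    have h := congrArg (fun A => A * adMat k W.B⁻¹) hline
    simp only [smul_mul_assoc, mul_assoc, hBinv, mul_one] at h
    exact h
  have hne : P i ≠ 0 := by
    intro h0
    have := hPr i
    rw [h0, Matrix.rank_zero] at this
    exact absurd this (by norm_num)
  obtain ⟨a, b, hab⟩ : ∃ a b, P i a b ≠ 0 := by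
    by_contra hcon
    refine hne (Matrix.ext fun a b => ?_)
    by_contra hab
    exact hcon ⟨a, b, hab⟩
  have hent := congrFun (congrFun hPeq a) b
  simp only [Matrix.smul_apply, smul_eq_mul, adMat, Matrix.map_apply] at hent
  have hu : IsUnit (ι (P i a b)) := (isUnit_iff_ne_zero.2 hab).map ι
  exact hu.mul_right_cancel (by rw [hent, one_mul])

end Torus

end Summit.Ventures.HodgeRepro.Tier4.Line4

end
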